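import Summits.RiemannHypothesis.RiemannHypothesis.Theorems.HandoffEdgeLayer
import Mathlib.Analysis.Calculus.BumpFunction.Basic
import HarnessLib

/-!
# HANDOFF, the cap is SHARP: antisymmetric two-layer pairs attain `contribution_q(g) = (log q/√q)·‖g‖₂²` (cell rh-explicit, TRACK «HANDOFF», seat theory-2)

HONEST FRAMING. Nothing here proves or approaches RH. The file of record `HandoffEdgeLayer.lean` proves the edge-layer
cap `|contribution_q(g)| ≤ cap(q)·‖g‖₂²`, `cap(q) = (log q)/√q = w_q/2`, for every test function on a window below
`log q`. Here the constant is shown to be OPTIMAL and ATTAINED inside the Weil test class: for every half-width `b`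
with `(log q)/2 < b` there is a smooth compactly supported `g ∈ C(b)`, `g ≠ 0`, with
`contribution_q(g) = cap(q)·‖g‖₂²` EXACTLY — the antisymmetric two-layer pair
`g(x) = ψ(x − L/2) − ψ(x + L/2)`, `L = log q`, `ψ` an even bump of outer radius `≤ b − L/2` (HANDOFF-STATEMENT.md §A.4 /
§D.1, where this was on paper: `k_g(±L) = −‖ψ‖₂² = −½‖g‖₂²`). Consequences typed: the maximal normalised contribution
on `C(b)` is `cap(q)` for every `b` in the half-open window `((log q)/2, (log q')/2]` (it is `0` at the closed left
end, `HandoffDecompositionConsequences.contribution_eq_zero_of_narrow`), so the aggregate necessary condition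
`N(q) : λ_min(S_q; b) ≥ −cap(q)` (`HandoffEdgeLayer.deficit_le_cap_of_handoffH`) is the best bound obtainable from the
contribution side alone: any constant `c` with `contribution_q ≤ c‖g‖₂²` on `C(b)` has `c ≥ cap(q)`
(`cap_le_of_forall_contribution_le`). NO new definitions (the witness is an explicit lambda).

References: E. Bombieri, Rend. Mat. Acc. Lincei (9) 11 (2000) §4 Lemma 2 (the crude bound `|k(x)| ≤ ‖g‖²`;
`Bombieri2000Weil`); A. Connes, C. Consani, Enseign. Math. 69 (2023) §2.2–2.3 (the contribution of a prime on its window,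
of either sign; `ConnesConsani2023`). The sharpness statement is this track's (HANDOFF-STATEMENT §A.4, §D.1).
-/

set_option linter.dupNamespace false  -- the mandated namespace repeats `RiemannHypothesis`

noncomputable section

open Set Filter MeasureTheory Metric Literature.NumberTheory.LFunctions
open Summit.RiemannHypothesis.RiemannHypothesis.Theorems.Handoff
open scoped ComplexConjugate

namespace Summit.RiemannHypothesis.RiemannHypothesis.Theorems.HandoffCapSharp

variable {q q' : ℕ} (ψ : ContDiffBump (0 : ℝ)) {L : ℝ}

/-! ## §1 Two-layer pairs of a bump: pointwise algebra (the layers are disjoint once `2·r_out ≤ L`) -/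

/-- Two copies of a bump centred at `0` whose arguments differ by at least twice its outer radius cannot both be
non-zero: `ψ u · ψ v = 0` whenever `2·r_out ≤ |u − v|`. [folklore] -/
theorem bump_mul_eq_zero_of_le_abs_sub {u v : ℝ} (h : 2 * ψ.rOut ≤ |u - v|) : ψ u * ψ v = 0 := by
  by_contra hne
  have hu' : u ∈ Function.support (ψ : ℝ → ℝ) := left_ne_zero_of_mul hne
  have hv' : v ∈ Function.support (ψ : ℝ → ℝ) := right_ne_zero_of_mul hne
  rw [ψ.support_eq, mem_ball, Real.dist_eq, sub_zero] at hu' hv'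
  have : |u - v| < 2 * ψ.rOut := by
    calc |u - v| ≤ |u| + |v| := abs_sub u v
      _ < ψ.rOut + ψ.rOut := add_lt_add hu' hv'
      _ = 2 * ψ.rOut := by ring
  exact absurd h (not_le.2 this)

/-- A bump is non-zero only within its outer radius: `ψ y ≠ 0 → |y| < r_out`. [folklore] -/
theorem abs_lt_rOut_of_ne_zero {y : ℝ} (hy : ψ y ≠ 0) : |y| < ψ.rOut := by
  have : y ∈ Function.support (ψ : ℝ → ℝ) := hy
  rwa [ψ.support_eq, mem_ball, Real.dist_eq, sub_zero] at this

/-- The two layers of `x ↦ ψ(x − L/2) − ψ(x + L/2)` are disjoint: `ψ(u − L/2)·ψ(u + L/2) = 0`. [folklore] -/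
theorem layer_mul_layer_eq_zero (hL : 2 * ψ.rOut ≤ L) (u : ℝ) : ψ (u - L / 2) * ψ (u + L / 2) = 0 := by
  refine bump_mul_eq_zero_of_le_abs_sub ψ ?_
  rw [show u - L / 2 - (u + L / 2) = -L by ring, abs_neg]
  exact hL.trans (le_abs_self L)

/-- Pointwise square of the pair: `(ψ(u − L/2) − ψ(u + L/2))² = ψ(u − L/2)² + ψ(u + L/2)²`. [folklore] -/
theorem twoLayer_sq (hL : 2 * ψ.rOut ≤ L) (u : ℝ) :
    (ψ (u - L / 2) - ψ (u + L / 2)) ^ 2 = ψ (u - L / 2) ^ 2 + ψ (u + L / 2) ^ 2 := by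
  linear_combination (-2 : ℝ) * layer_mul_layer_eq_zero ψ hL u

/-- Pointwise product of the pair with its translate by `L` (the autocorrelation integrand at lag `L`):
`(ψ(u − L/2) − ψ(u + L/2))·(ψ(u − L − L/2) − ψ(u − L + L/2)) = −ψ(u − L/2)²` — only the right layer meets the
translated left layer, with opposite signs. [this track, HANDOFF-STATEMENT §A.4] -/
theorem twoLayer_mul_translate (hL : 2 * ψ.rOut ≤ L) (u : ℝ) :
    (ψ (u - L / 2) - ψ (u + L / 2)) * (ψ (u - L - L / 2) - ψ (u - L + L / 2)) = -(ψ (u - L / 2) ^ 2) := by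
  have hLnn : 0 ≤ L := le_trans (by linarith [ψ.rOut_pos]) hL
  have e1 : u - L - L / 2 = u - 3 * L / 2 := by ring
  have e2 : u - L + L / 2 = u - L / 2 := by ring
  have h1 : ψ (u - L / 2) * ψ (u + L / 2) = 0 := layer_mul_layer_eq_zero ψ hL u
  have h2 : ψ (u - L / 2) * ψ (u - 3 * L / 2) = 0 := by
    refine bump_mul_eq_zero_of_le_abs_sub ψ ?_
    rw [show u - L / 2 - (u - 3 * L / 2) = L by ring, abs_of_nonneg hLnn]; exact hL
  have h3 : ψ (u + L / 2) * ψ (u - 3 * L / 2) = 0 := by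
    refine bump_mul_eq_zero_of_le_abs_sub ψ ?_
    rw [show u + L / 2 - (u - 3 * L / 2) = 2 * L by ring, abs_of_nonneg (by linarith)]; linarith
  rw [e1, e2]
  linear_combination h2 - h3 + h1

/-! ## §2 The integrals: `‖g‖₂² = 2‖ψ‖₂²`, `k_g(L) = −‖ψ‖₂²` -/

/-- `ψ²` is integrable (continuous, compact support). [folklore] -/
theorem integrable_bump_sq : Integrable fun y : ℝ ↦ ψ y ^ 2 := by
  have hs : HasCompactSupport fun y : ℝ ↦ ψ y ^ 2 := by
    have h := ψ.hasCompactSupport.mul_right (f' := (ψ : ℝ → ℝ))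
    have e : ((ψ : ℝ → ℝ) * (ψ : ℝ → ℝ)) = fun y : ℝ ↦ ψ y ^ 2 := by funext y; simp [sq]
    rwa [e] at h
  exact (ψ.continuous.pow 2).integrable_of_hasCompactSupport hs

/-- `0 < ∫ ψ²`. [folklore] -/
theorem integral_bump_sq_pos : 0 < ∫ y : ℝ, ψ y ^ 2 := by
  rw [integral_pos_iff_support_of_nonneg (fun y ↦ sq_nonneg _) (integrable_bump_sq ψ)]
  have hs : Function.support (fun y : ℝ ↦ ψ y ^ 2) = ball (0 : ℝ) ψ.rOut := by
    rw [Function.support_pow _ two_ne_zero, ψ.support_eq]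
  rw [hs, Real.volume_ball]
  have : 0 < 2 * ψ.rOut := by linarith [ψ.rOut_pos]
  simpa using this

/-- `∫ (ψ(u − L/2) − ψ(u + L/2))² du = 2 ∫ ψ²`. [folklore] -/
theorem integral_twoLayer_sq (hL : 2 * ψ.rOut ≤ L) :
    ∫ u : ℝ, (ψ (u - L / 2) - ψ (u + L / 2)) ^ 2 = 2 * ∫ y : ℝ, ψ y ^ 2 := by
  have hIm : ∫ u : ℝ, ψ (u - L / 2) ^ 2 = ∫ y : ℝ, ψ y ^ 2 :=
    integral_sub_right_eq_self (fun y : ℝ ↦ ψ y ^ 2) (L / 2)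
  have hIp : ∫ u : ℝ, ψ (u + L / 2) ^ 2 = ∫ y : ℝ, ψ y ^ 2 :=
    integral_add_right_eq_self (fun y : ℝ ↦ ψ y ^ 2) (L / 2)
  have e : (fun u : ℝ ↦ (ψ (u - L / 2) - ψ (u + L / 2)) ^ 2) = fun u : ℝ ↦ ψ (u - L / 2) ^ 2 + ψ (u + L / 2) ^ 2 := by
    funext u; exact twoLayer_sq ψ hL u
  rw [e, integral_add ((integrable_bump_sq ψ).comp_sub_right (L / 2)) ((integrable_bump_sq ψ).comp_add_right (L / 2)),
    hIm, hIp]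
  ring

/-- `∫ (ψ(u − L/2) − ψ(u + L/2))·(ψ(u − L − L/2) − ψ(u − L + L/2)) du = −∫ ψ²` (the autocorrelation at lag `L`). [this track] -/
theorem integral_twoLayer_mul_translate (hL : 2 * ψ.rOut ≤ L) :
    ∫ u : ℝ, (ψ (u - L / 2) - ψ (u + L / 2)) * (ψ (u - L - L / 2) - ψ (u - L + L / 2)) = -∫ y : ℝ, ψ y ^ 2 := by
  have e : (fun u : ℝ ↦ (ψ (u - L / 2) - ψ (u + L / 2)) * (ψ (u - L - L / 2) - ψ (u - L + L / 2))) =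
      fun u : ℝ ↦ -(ψ (u - L / 2) ^ 2) := by
    funext u; exact twoLayer_mul_translate ψ hL u
  rw [e, integral_neg, integral_sub_right_eq_self (fun y : ℝ ↦ ψ y ^ 2) (L / 2)]

/-! ## §3 The pair as a Weil test function: class, support, norm, autocorrelation at lag `±L`, contribution -/

/-- The complexified pair `g(x) = ψ(x − L/2) − ψ(x + L/2)` is a Weil test function. [folklore] -/
theorem isWeilTest_twoLayer (L : ℝ) :
    IsWeilTest fun x : ℝ ↦ (((ψ (x - L / 2) - ψ (x + L / 2) : ℝ)) : ℂ) := by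
  have hψt : IsWeilTest fun x : ℝ ↦ ((ψ x : ℝ) : ℂ) :=
    ⟨Complex.ofRealCLM.contDiff.comp ψ.contDiff, ψ.hasCompactSupport.comp_left Complex.ofReal_zero⟩
  have e1 : (fun x : ℝ ↦ ((ψ (x - L / 2) : ℝ) : ℂ)) = weilTranslate (fun x : ℝ ↦ ((ψ x : ℝ) : ℂ)) (L / 2) := by
    funext x; simp [weilTranslate]
  have e2 : (fun x : ℝ ↦ ((ψ (x + L / 2) : ℝ) : ℂ)) = weilTranslate (fun x : ℝ ↦ ((ψ x : ℝ) : ℂ)) (-(L / 2)) := by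
    funext x; simp [weilTranslate]
  have hg1 : IsWeilTest fun x : ℝ ↦ ((ψ (x - L / 2) : ℝ) : ℂ) := by rw [e1]; exact hψt.weilTranslate _
  have hg2 : IsWeilTest fun x : ℝ ↦ ((ψ (x + L / 2) : ℝ) : ℂ) := by rw [e2]; exact hψt.weilTranslate _
  have e : (fun x : ℝ ↦ (((ψ (x - L / 2) - ψ (x + L / 2) : ℝ)) : ℂ)) =
      (fun x : ℝ ↦ ((ψ (x - L / 2) : ℝ) : ℂ)) + fun x : ℝ ↦ (-1 : ℂ) * ((ψ (x + L / 2) : ℝ) : ℂ) := by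
    funext x; simp only [Pi.add_apply]; push_cast; ring
  rw [e]
  exact hg1.add (hg2.const_mul (-1))

/-- Its support lies in `[−(r_out + L/2), r_out + L/2]`, hence in `[−b, b]` once `r_out + L/2 ≤ b`. [folklore] -/
theorem tsupport_twoLayer_subset (hL : 0 ≤ L) {b : ℝ} (hb : ψ.rOut + L / 2 ≤ b) :
    tsupport (fun x : ℝ ↦ (((ψ (x - L / 2) - ψ (x + L / 2) : ℝ)) : ℂ)) ⊆ Icc (-b) b := by
  refine closure_minimal ?_ isClosed_Icc
  intro x hx
  have hx' : ψ (x - L / 2) - ψ (x + L / 2) ≠ 0 := fun h0 ↦ hx (by simp only [h0, Complex.ofReal_zero])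
  have hcase : ψ (x - L / 2) ≠ 0 ∨ ψ (x + L / 2) ≠ 0 := by
    by_contra hh
    simp only [not_or, not_not] at hh
    exact hx' (by rw [hh.1, hh.2, sub_self])
  rcases hcase with h | h
  · have := abs_lt_rOut_of_ne_zero ψ h
    rw [abs_lt] at this
    constructor <;> linarith [this.1, this.2]
  · have := abs_lt_rOut_of_ne_zero ψ h
    rw [abs_lt] at this
    constructor <;> linarith [this.1, this.2]

/-- `‖g‖₂² = 2‖ψ‖₂²` for the pair. [folklore] -/
theorem integral_norm_sq_twoLayer (hL : 2 * ψ.rOut ≤ L) :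
    ∫ u : ℝ, ‖(((ψ (u - L / 2) - ψ (u + L / 2) : ℝ)) : ℂ)‖ ^ 2 = 2 * ∫ y : ℝ, ψ y ^ 2 := by
  have e : (fun u : ℝ ↦ ‖(((ψ (u - L / 2) - ψ (u + L / 2) : ℝ)) : ℂ)‖ ^ 2) =
      fun u : ℝ ↦ (ψ (u - L / 2) - ψ (u + L / 2)) ^ 2 := by
    funext u; rw [Complex.norm_real, Real.norm_eq_abs, sq_abs]
  rw [e, integral_twoLayer_sq ψ hL]

/-- The autocorrelation of the pair at lag `L` is `−‖ψ‖₂²`: `k_g(L) = ∫ g(u) conj g(u − L) du = −∫ψ²`. [this track, HANDOFF-STATEMENT §A.4] -/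
theorem weilConv_weilReflect_twoLayer (hL : 2 * ψ.rOut ≤ L) :
    weilConv (fun x : ℝ ↦ (((ψ (x - L / 2) - ψ (x + L / 2) : ℝ)) : ℂ))
        (weilReflect fun x : ℝ ↦ (((ψ (x - L / 2) - ψ (x + L / 2) : ℝ)) : ℂ)) L =
      ((-∫ y : ℝ, ψ y ^ 2 : ℝ) : ℂ) := by
  rw [weilConv_apply]
  have e : (fun u : ℝ ↦ (((ψ (u - L / 2) - ψ (u + L / 2) : ℝ)) : ℂ) *
        weilReflect (fun x : ℝ ↦ (((ψ (x - L / 2) - ψ (x + L / 2) : ℝ)) : ℂ)) (L - u)) =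
      fun u : ℝ ↦ ((((ψ (u - L / 2) - ψ (u + L / 2)) * (ψ (u - L - L / 2) - ψ (u - L + L / 2)) : ℝ)) : ℂ) := by
    funext u
    simp only [weilReflect, neg_sub, Complex.conj_ofReal]
    push_cast
    ring
  rw [e, integral_complex_ofReal, integral_twoLayer_mul_translate ψ hL]

/-- … and at lag `−L` as well (`k_g(−L) = conj k_g(L)` is real here). [this track] -/
theorem weilConv_weilReflect_twoLayer_neg (hL : 2 * ψ.rOut ≤ L) :
    weilConv (fun x : ℝ ↦ (((ψ (x - L / 2) - ψ (x + L / 2) : ℝ)) : ℂ))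
        (weilReflect fun x : ℝ ↦ (((ψ (x - L / 2) - ψ (x + L / 2) : ℝ)) : ℂ)) (-L) =
      ((-∫ y : ℝ, ψ y ^ 2 : ℝ) : ℂ) := by
  rw [← conj_weilConv_weilReflect_neg _ (-L), neg_neg, weilConv_weilReflect_twoLayer ψ hL, Complex.conj_ofReal]

/-- **The contribution of `q` at the pair with `L = log q` is `cap(q)·‖g‖₂²`**:
`contribution_q(g) = −(log q/√q)·Re(k_g(L) + k_g(−L)) = (log q/√q)·2‖ψ‖₂² = (log q/√q)·‖g‖₂²`.
[cite: ConnesConsani2023, §2.2–§2.3 (a prime's contribution on its window); sharpness: this track, HANDOFF-STATEMENT §A.4/§D.1] -/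
theorem contribution_twoLayer (hL : 2 * ψ.rOut ≤ Real.log q) :
    contribution q (fun x : ℝ ↦ (((ψ (x - Real.log q / 2) - ψ (x + Real.log q / 2) : ℝ)) : ℂ)) =
      Real.log q / Real.sqrt q *
        ∫ u : ℝ, ‖(((ψ (u - Real.log q / 2) - ψ (u + Real.log q / 2) : ℝ)) : ℂ)‖ ^ 2 := by
  unfold contribution
  rw [weilConv_weilReflect_twoLayer ψ hL, weilConv_weilReflect_twoLayer_neg ψ hL, integral_norm_sq_twoLayer ψ hL,
    ← Complex.ofReal_add, Complex.ofReal_re]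
  ring

/-! ## §4 The cap is attained: existence statements on `C(b)` and on the window; optimality of the constant -/

/-- **The cap is attained (core statement).** Let `1 < q` and `(log q)/2 < b ≤ log q`. Then some Weil test function
`g ∈ C(b)` with `‖g‖₂² > 0` has `contribution_q(g) = (log q/√q)·‖g‖₂²` — namely the antisymmetric two-layer pair
`ψ(x − L/2) − ψ(x + L/2)`, `L = log q`, `ψ` the bump with radii `(b − L/2)/2 < b − L/2`.
[cite: ConnesConsani2023, §2.2–§2.3; sharpness: this track, HANDOFF-STATEMENT §A.4/§D.1] -/
theorem exists_contribution_eq_cap_mul_of_le (hq : 1 < q) {b : ℝ} (hb : Real.log q / 2 < b)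
    (hbL : b ≤ Real.log q) :
    ∃ g : ℝ → ℂ, IsWeilTest g ∧ tsupport g ⊆ Icc (-b) b ∧ 0 < ∫ u : ℝ, ‖g u‖ ^ 2 ∧
      contribution q g = Real.log q / Real.sqrt q * ∫ u : ℝ, ‖g u‖ ^ 2 := by
  have hL : 0 < Real.log q := Real.log_pos (by exact_mod_cast hq)
  have hr : 0 < b - Real.log q / 2 := by linarith
  let ψ : ContDiffBump (0 : ℝ) := ⟨(b - Real.log q / 2) / 2, b - Real.log q / 2, by positivity, by linarith⟩
  have hψr : ψ.rOut = b - Real.log q / 2 := rfl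
  have hL2 : 2 * ψ.rOut ≤ Real.log q := by rw [hψr]; linarith
  refine ⟨fun x : ℝ ↦ (((ψ (x - Real.log q / 2) - ψ (x + Real.log q / 2) : ℝ)) : ℂ), isWeilTest_twoLayer ψ _,
    tsupport_twoLayer_subset ψ hL.le (by rw [hψr]; linarith), ?_, contribution_twoLayer ψ hL2⟩
  rw [integral_norm_sq_twoLayer ψ hL2]
  have := integral_bump_sq_pos ψ
  positivity

/-- **The cap is attained on every `C(b)` with `b > (log q)/2`** (no upper constraint on `b`: the witness for
`min(b, log q)` serves). [cite: ConnesConsani2023, §2.2–§2.3; sharpness: this track] -/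
theorem exists_contribution_eq_cap_mul (hq : 1 < q) {b : ℝ} (hb : Real.log q / 2 < b) :
    ∃ g : ℝ → ℂ, IsWeilTest g ∧ tsupport g ⊆ Icc (-b) b ∧ 0 < ∫ u : ℝ, ‖g u‖ ^ 2 ∧
      contribution q g = Real.log q / Real.sqrt q * ∫ u : ℝ, ‖g u‖ ^ 2 := by
  have hL : 0 < Real.log q := Real.log_pos (by exact_mod_cast hq)
  have hb₀ : Real.log q / 2 < min b (Real.log q) := lt_min hb (by linarith)
  obtain ⟨g, hg, hsupp, hpos, heq⟩ := exists_contribution_eq_cap_mul_of_le hq hb₀ (min_le_right _ _)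
  exact ⟨g, hg, hsupp.trans (Icc_subset_Icc (neg_le_neg (min_le_left _ _)) (min_le_left _ _)), hpos, heq⟩

/-- **On the handoff window**: for consecutive primes `q < q'` and every `b` in the HALF-OPEN window
`((log q)/2, (log q')/2]` the cap is attained on `C(b)` by a non-zero test function (so `K_q(b) = (log q)/√q` there;
it is `0` at the closed left end, `HandoffDecompositionConsequences.contribution_eq_zero_of_narrow`).
[cite: ConnesConsani2023, §2.2–§2.3; this track, HANDOFF-STATEMENT §D.1] -/
theorem exists_contribution_eq_cap_mul_of_window (h : ConsecutivePrimes q q') {b : ℝ}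
    (hb : b ∈ Ioc (Real.log q / 2) (Real.log q' / 2)) :
    ∃ g : ℝ → ℂ, IsWeilTest g ∧ tsupport g ⊆ Icc (-b) b ∧ 0 < ∫ u : ℝ, ‖g u‖ ^ 2 ∧
      contribution q g = Real.log q / Real.sqrt q * ∫ u : ℝ, ‖g u‖ ^ 2 :=
  exists_contribution_eq_cap_mul h.1.one_lt hb.1

/-- **Optimality of the constant**: if `contribution_q(g) ≤ c·‖g‖₂²` for every test `g ∈ C(b)` with some
`b > (log q)/2`, then `c ≥ cap(q) = (log q)/√q`. So the sharp aggregate necessary condition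
`N(q) : deficit_q ≤ cap(q)‖g‖₂²` (`HandoffEdgeLayer.deficit_le_cap_of_handoffH`) cannot be improved through the
contribution bound alone. [this track, HANDOFF-STATEMENT §D.1–§D.2] -/
theorem cap_le_of_forall_contribution_le (hq : 1 < q) {b c : ℝ} (hb : Real.log q / 2 < b)
    (hc : ∀ g : ℝ → ℂ, IsWeilTest g → tsupport g ⊆ Icc (-b) b → contribution q g ≤ c * ∫ u : ℝ, ‖g u‖ ^ 2) :
    Real.log q / Real.sqrt q ≤ c := by
  obtain ⟨g, hg, hsupp, hpos, heq⟩ := exists_contribution_eq_cap_mul hq hb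
  have h := hc g hg hsupp
  rw [heq] at h
  exact le_of_mul_le_mul_right h hpos

/-- **The maximal contribution on the window, both sides in one statement**: for consecutive primes `q < q'` and
`b ∈ ((log q)/2, (log q')/2]`, `cap(q)·‖g‖₂²` bounds `contribution_q(g)` for every `g ∈ C(b)` AND is attained by a
non-zero `g ∈ C(b)` — i.e. `K_q(b) = (log q)/√q` exactly (HANDOFF-STATEMENT §D.1, formerly on paper).
[cite: ConnesConsani2023, §2.2–§2.3; this track] -/
theorem maxContribution_window (h : ConsecutivePrimes q q') {b : ℝ} (hb : b ∈ Ioc (Real.log q / 2) (Real.log q' / 2)) :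
    (∀ g : ℝ → ℂ, IsWeilTest g → tsupport g ⊆ Icc (-b) b →
        contribution q g ≤ Real.log q / Real.sqrt q * ∫ u : ℝ, ‖g u‖ ^ 2) ∧
      ∃ g : ℝ → ℂ, IsWeilTest g ∧ tsupport g ⊆ Icc (-b) b ∧ 0 < ∫ u : ℝ, ‖g u‖ ^ 2 ∧
        contribution q g = Real.log q / Real.sqrt q * ∫ u : ℝ, ‖g u‖ ^ 2 :=
  ⟨fun _ hg hsupp ↦ (le_abs_self _).trans (HandoffEdgeLayer.abs_contribution_le_of_window h hg hb.2 hsupp),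
    exists_contribution_eq_cap_mul_of_window h hb⟩

end Summit.RiemannHypothesis.RiemannHypothesis.Theorems.HandoffCapSharp

end
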